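import Summits.Ventures.CertifiedManyBodySolver.Certificates.HubbardSquare_kdwidth_M53Av4_T
import Summits.Ventures.CertifiedManyBodySolver.Certificates.HubbardSquare_transportClosureCells_LSCOu_G
import HarnessLib

/-!
# Ventures/CertifiedManyBodySolver — Certificates/HubbardSquare_kdwidth_M53Av4_H4.lean (hubbard-box-p2 g22: KD-WIDTH v4 M53Av4, bridging lemmas part 4 of 4)

Per-word bridging: each cited landed word (its premises supplied from the bundle `kdw_M53Av4_Premises`) ⇒ `WordRec.Holds e₀` of its
record in `HubbardSquare_kdwidth_M53Av4_T*`. Proof shape: the record's corner functions equal the word's literal box (`fin_cases; norm_num`), apply the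
word, `norm_num [record, mlEval_vec8]` on both sides, `linarith`. WHAT THIS IS NOT: a new word.
-/

noncomputable section

namespace Summit.Ventures.CertifiedManyBodySolver.Certificates

open Literature.MathematicalPhysics.QuantumLattice
open Literature.MathematicalPhysics.QuantumLattice.ThermodynamicLimit
open Literature.MathematicalPhysics.QuantumLattice Literature.MathematicalPhysics.QuantumLattice.ThermodynamicLimit
open Literature.MathematicalPhysics.QuantumLattice.ClusterLowerBound
open Literature.MathematicalPhysics.QuantumLattice.TTPrimeFree
open Literature.Probability.LatticeModels
open Matrix Finset Filter Topology
open NonemptyInterval Literature.MathematicalPhysics.QuantumLattice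
open Set
open Summit.Ventures.CertifiedManyBodySolver.Certificates
open Summit.Ventures.CertifiedManyBodySolver.Certificates.BoxWordGC
open Summit.Ventures.CertifiedManyBodySolver.Certificates.DerivedNTangentR473Sym
open scoped ComplexOrder ComplexConjugate Topology BigOperators
open Literature.Computation.Certificates.BoxCovering
open Literature.Analysis.ValidatedNumerics (KdCert)

/-- Word 101 holds for `e₀`: the landed theorem `tcc_LSCOu_c62_nchord_mlword_Icc`. -/
theorem kdw_M53Av4_w101_holds (H : kdw_M53Av4_Premises) : kdw_M53Av4_w101.Holds (fun θ : Fin 3 → ℝ => energyDensityTT' 1 (θ 1) (θ 0) (θ 2)) := by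
  intro θ hθ
  have eL : (fun k : Fin 3 => ((kdw_M53Av4_w101.lo k : ℚ) : ℝ)) = (![12, -1/4, 15/16] : Fin 3 → ℝ) := by funext k; fin_cases k <;> norm_num [kdw_M53Av4_w101]
  have eH : (fun k : Fin 3 => ((kdw_M53Av4_w101.hi k : ℚ) : ℝ)) = (![14, -1/5, 199/200] : Fin 3 → ℝ) := by funext k; fin_cases k <;> norm_num [kdw_M53Av4_w101]
  have hw := Summit.Ventures.CertifiedManyBodySolver.Certificates.tcc_LSCOu_c62_nchord_mlword_Icc H.hB3d0 H.hsX12m30 H.hsX12m20 H.hsX12m25n15o16 H.hsX12p00n15o16 H.hB3c1 H.h469 θ (by rw [← eL, ← eH]; exact hθ)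
  constructor
  · have h := hw.1; norm_num [kdw_M53Av4_w101, mlEval_vec8] at h ⊢; linarith
  · have h := hw.2; norm_num [kdw_M53Av4_w101, mlEval_vec8] at h ⊢; linarith

end Summit.Ventures.CertifiedManyBodySolver.Certificates

end
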